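import Summits.AtomisticToContinuum.Crystallization.Theorems.ThreeConeCertificateSlackRigidityUniqWSound
import Summits.AtomisticToContinuum.Crystallization.Theorems.ThreeConeCertificateSlackRigidityUniqCalculus
import Summits.AtomisticToContinuum.Crystallization.Theorems.PalmUnimodularRigidityLayeredLawsSelectHcpRelaxedReferenceTail
import HarnessLib

/-!
# Weighted hcp shape sums for every layer ratio: certificates, the Fermat cell lemma, derivatives
(crux `SlackRigidity`, stmt-AtomisticToContinuum-11960, line `ekeland-surgery-parity`, numerics stub
`stub_hcpShapeUniqueMax` of the reshaped `stub_hcpOptimalCongruent`)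

Packaging for the `F' > 0` certificate on the middle window `[7/10, 9/10]`:
* the weighted sums `D_n = hcpSumW 1 (n+1)`, `E_n = hcpSumW 2 (n+2)` (`…UniqSums`, `…UniqWSound`) for EVERY
  `c > 0` — summability, antitonicity, and the certified bounds at rational `c = p/q` with the tree's
  general-layer-ratio cube tails (`hcpSum_sdiff_cube_le_gen`, `…RelaxedReferenceTail`):
  `hcpSumW_ge_cert_gen`, `hcpSumW_le_cert_gen`;
* the CELL LEMMA `fermat_cell`: monotone bracketing of the six sums on `[c_L, c_R]` and one rational check
  `14 s₃ e₆ − 8 s₆ e₃ − 6 d₃ d₆ > 0` give `14 S₃E₆ − 8 S₆E₃ − 6 D₃D₆ > 0` on the cell;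
* the derivative relations in the tree's vocabulary: `(hcpSumS e)' = −2ec · hcpSumW 1 (e+1)`,
  `(hcpSumW 1 (e+1))' = −2(e+1)c · hcpSumW 2 (e+2)` (`hcpSumS_hasDerivAt`, `hcpSumD_hasDerivAt`, from the
  weighted term-wise differentiation `hcpW_hasDerivAt_tsum` of `…UniqCalculus`).
All `[folklore]`.
-/

noncomputable section

namespace Summit.AtomisticToContinuum.Crystallization.Theorems.EkelandSurgeryParityUniq

open Finset
open Summit.AtomisticToContinuum.Crystallization.Theorems.ExcessDecayLiouvilleCoarseGrains
open Summit.AtomisticToContinuum.Crystallization.Theorems.PalmUnimodularRigidity.LayeredLawsSelectHcp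

/-! ## Weighted sums for every `c > 0` -/

/-- **Summability** of the weighted family for every `c > 0` (`e − m ≥ 3`). [folklore] -/
theorem hcpSumW_summable_gen {m e : ℕ} (h3 : 3 ≤ e - m) (hme : m ≤ e) {c : ℝ} (hc : 0 < c) :
    Summable (hcpSumTermW m e c) :=
  hcpSumTermW_summable hme hc.ne' (hcpSumTerm_summable_gen h3 hc)

/-- **Antitonicity** of the weighted sums on `(0, ∞)`. [folklore] -/
theorem hcpSumW_antitone_gen {m e : ℕ} (h3 : 3 ≤ e - m) (hme : m ≤ e) {c₁ c₂ : ℝ} (h₁ : 0 < c₁)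
    (h₁₂ : c₁ ≤ c₂) : hcpSumW m e c₂ ≤ hcpSumW m e c₁ :=
  hcpSumW_antitone h₁ h₁₂ (hcpSumW_summable_gen h3 hme h₁) (hcpSumW_summable_gen h3 hme (h₁.trans_le h₁₂))

/-- **Certified lower bound** for the weighted sum at rational `c = p/q > 0`. [folklore] -/
theorem hcpSumW_ge_cert_gen {m e : ℕ} (h3 : 3 ≤ e - m) (hme : m ≤ e) {p q : ℕ} (hp : 0 < p) (hq : 0 < q)
    (K : ℕ) {M : ℕ} (hM : 0 < M) :
    (3 * (q : ℝ) ^ 2) ^ e * (hcpSumFloorSumW p q K m e M : ℝ) / M ≤ hcpSumW m e ((p : ℝ) / q) :=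
  hcpSumW_ge_certW hp hq (hcpSumW_summable_gen h3 hme (by positivity)) K hM

/-- **Certified upper bound** for the weighted sum at rational `c = p/q`, tail `(c²)⁻ᵐ ((3/5)/θ)^{e−m} T(e−m, K)`
for `0 < θ ≤ 3/5`, `θ ≤ c²`. [folklore] -/
theorem hcpSumW_le_cert_gen {m e : ℕ} (h3 : 3 ≤ e - m) (hme : m ≤ e) {p q : ℕ} (hp : 0 < p) (hq : 0 < q)
    {θ : ℝ} (hθ : 0 < θ) (hθ' : θ ≤ 3 / 5) (hc : θ ≤ ((p : ℝ) / q) ^ 2) {K : ℕ} (hK : 4 ≤ K)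
    {M : ℕ} (hM : 0 < M) :
    hcpSumW m e ((p : ℝ) / q) ≤
      (3 * (q : ℝ) ^ 2) ^ e * ((hcpSumFloorSumW p q K m e M : ℝ) + (2 * K + 1) ^ 3) / M +
        ((((p : ℝ) / q) ^ 2)⁻¹) ^ m * (((3 / 5) / θ) ^ (e - m) * hcpSumTail (e - m) K) :=
  hcpSumW_le_certW hme hp hq (fun _ hK' => hcpSum_sdiff_cube_le_gen h3 hθ hθ' hc hK hK') hM

/-! ## The Fermat cell lemma -/

/-- **Fermat cell.**  On `[c_L, c_R] ⊂ (0, ∞)`, lower bounds for `S₃, E₆` at `c_R`, upper bounds for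
`S₆, E₃, D₃, D₆` at `c_L` and the rational check `0 < 14 s₃e₆ − 8 s₆e₃ − 6 d₃d₆` give
`0 < 14 S₃E₆ − 8 S₆E₃ − 6 D₃D₆` on the whole cell (all six sums are antitone in `c`). [folklore] -/
theorem fermat_cell {cL cR : ℝ} (h0 : 0 < cL) {s₃ e₆ s₆ e₃ d₃ d₆ : ℝ}
    (hs₃ : s₃ ≤ hcpSumS 3 cR) (he₆ : e₆ ≤ hcpSumW 2 8 cR)
    (hs₆ : hcpSumS 6 cL ≤ s₆) (he₃ : hcpSumW 2 5 cL ≤ e₃)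
    (hd₃ : hcpSumW 1 4 cL ≤ d₃) (hd₆ : hcpSumW 1 7 cL ≤ d₆)
    (hs₃0 : 0 ≤ s₃) (he₆0 : 0 ≤ e₆) (hnum : 0 < 14 * s₃ * e₆ - 8 * s₆ * e₃ - 6 * d₃ * d₆) :
    ∀ x : ℝ, cL ≤ x → x ≤ cR →
      0 < 14 * hcpSumS 3 x * hcpSumW 2 8 x - 8 * hcpSumS 6 x * hcpSumW 2 5 x -
        6 * hcpSumW 1 4 x * hcpSumW 1 7 x := by
  intro x hxL hxR
  have hx : 0 < x := lt_of_lt_of_le h0 hxL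
  have e3 : (3 : ℕ) ≤ 3 := le_rfl
  have e6 : (3 : ℕ) ≤ 6 := by norm_num
  -- the six brackets at `x`
  have a1 : s₃ ≤ hcpSumS 3 x := hs₃.trans (hcpSumS_antitone_gen e3 hx hxR)
  have a2 : e₆ ≤ hcpSumW 2 8 x := he₆.trans (hcpSumW_antitone_gen (by norm_num) (by norm_num) hx hxR)
  have a3 : hcpSumS 6 x ≤ s₆ := (hcpSumS_antitone_gen e6 h0 hxL).trans hs₆
  have a4 : hcpSumW 2 5 x ≤ e₃ := (hcpSumW_antitone_gen (by norm_num) (by norm_num) h0 hxL).trans he₃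
  have a5 : hcpSumW 1 4 x ≤ d₃ := (hcpSumW_antitone_gen (by norm_num) (by norm_num) h0 hxL).trans hd₃
  have a6 : hcpSumW 1 7 x ≤ d₆ := (hcpSumW_antitone_gen (by norm_num) (by norm_num) h0 hxL).trans hd₆
  have p6 : 0 ≤ hcpSumS 6 x := (lt_of_lt_of_le one_pos (hcpSum_one_le_hcpSumS_gen e6 hx)).le
  have p4 : 0 ≤ hcpSumW 2 5 x := hcpSumW_nonneg _ _ _
  have p5 : 0 ≤ hcpSumW 1 4 x := hcpSumW_nonneg _ _ _
  have p7 : 0 ≤ hcpSumW 1 7 x := hcpSumW_nonneg _ _ _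
  have m1 : s₃ * e₆ ≤ hcpSumS 3 x * hcpSumW 2 8 x := mul_le_mul a1 a2 he₆0 (hs₃0.trans a1)
  have m2 : hcpSumS 6 x * hcpSumW 2 5 x ≤ s₆ * e₃ := mul_le_mul a3 a4 p4 (p6.trans a3)
  have m3 : hcpSumW 1 4 x * hcpSumW 1 7 x ≤ d₃ * d₆ := mul_le_mul a5 a6 p7 (p5.trans a5)
  nlinarith

/-! ## Derivatives in the tree's vocabulary -/

/-- The form `hcpSumQ` is positive off the origin on the layer `k = 0`. [folklore] -/
theorem hcpSumQ_pos_layer_zero (v : ℤ × ℤ × ℤ) (hv : v ≠ 0) (hk : v.1 = 0) : 0 < hcpSumQ v := by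
  have := hcpSum_r_pos hv (c := 1) one_ne_zero
  rw [hk] at this
  simpa using this

/-- **`(hcpSumS e)' = −2ec · D`**, `D = hcpSumW 1 (e+1)`, for every `c > 0`, `e ≥ 3`. [folklore] -/
theorem hcpSumS_hasDerivAt {e : ℕ} (he : 3 ≤ e) {c : ℝ} (hc : 0 < c) :
    HasDerivAt (hcpSumS e) (-(2 * e * c) * hcpSumW 1 (e + 1) c) c := by
  have key := hcpW_hasDerivAt_tsum (Q := hcpSumQ) hcpSumQ_nonneg hcpSumQ_pos_layer_zero 0 e hc
    (hcpSumW_summable_gen (m := 0) (e := e) (by simpa using he) (Nat.zero_le e) (half_pos hc))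
    (hcpSumW_summable_gen (m := 0) (e := e) (by simpa using he) (Nat.zero_le e) hc)
  have hfun : (fun y : ℝ => ∑' v : ℤ × ℤ × ℤ,
      if v = 0 then (0 : ℝ) else ((v.1 : ℝ) ^ 2) ^ 0 * ((hcpSumQ v + (v.1 : ℝ) ^ 2 * y ^ 2)⁻¹) ^ e) =
      hcpSumS e := by
    funext y
    exact hcpSumW_zero e y
  rw [hfun] at key
  exact key

/-- **`(hcpSumW 1 (e+1))' = −2(e+1)c · E`**, `E = hcpSumW 2 (e+2)`, for every `c > 0`, `e ≥ 3`. [folklore] -/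
theorem hcpSumD_hasDerivAt (e : ℕ) (he : 3 ≤ e) {c : ℝ} (hc : 0 < c) :
    HasDerivAt (hcpSumW 1 (e + 1)) (-(2 * (e + 1 : ℕ) * c) * hcpSumW 2 (e + 2) c) c := by
  have key := hcpW_hasDerivAt_tsum (Q := hcpSumQ) hcpSumQ_nonneg hcpSumQ_pos_layer_zero 1 (e + 1) hc
    (hcpSumW_summable_gen (m := 1) (e := e + 1) (by omega) (by omega) (half_pos hc))
    (hcpSumW_summable_gen (m := 1) (e := e + 1) (by omega) (by omega) hc)
  exact key

/-- Anchor (registered sub-goal `uniqWCert_anchor` of stmt-AtomisticToContinuum-11960): summability of the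
weighted family for every `c > 0`. [folklore] -/
theorem uniqWCert_anchor :
    ∀ (m e : ℕ), 3 ≤ e - m → m ≤ e → ∀ (c : ℝ), 0 < c → Summable (hcpSumTermW m e c) :=
  fun _ _ h3 hme _ hc => hcpSumW_summable_gen h3 hme hc

end Summit.AtomisticToContinuum.Crystallization.Theorems.EkelandSurgeryParityUniq

end
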